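import Mathlib
import Summits.Ventures.PercRepro2.Defs
import Summits.Ventures.PercRepro2.Graph
import Summits.Ventures.PercRepro2.Events
import Summits.Ventures.PercRepro2.Harris
import Summits.Ventures.PercRepro2.Induced
import Summits.Ventures.PercRepro2.BHKEvents
import Summits.Ventures.PercRepro2.BHKAvoid
import Summits.Ventures.PercRepro2.JOneB

/-!
# The weighted case-mean inequality (b) of the (J1) line (blind cell PercRepro2, mine-1)

`jOneB` (JOneB.lean) is `P(o ∈ C₂ | a₃ ∈ C₁, Q) ≤ γ`, `γ = P(o ∈ U | a₃ ∉ U, Q)`.  The same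
cross-cluster inequality with set avoidance gives it with any up-set `𝓤` of the cluster of `a₁`
added to the conditioning:

  **(b_𝓤)**  `P(o ∈ C₂ | a₃ ∈ C₁, C₁ ∈ 𝓤, Q) ≤ γ`,

multiplied out (`jOneB_upset`):
`P(o ∈ C₂, a₃ ∈ C₁, C₁ ∈ 𝓤, Q) · P(a₃ ∉ U, Q) ≤ P(a₃ ∈ C₁, C₁ ∈ 𝓤, Q) · P(o ∈ U, a₃ ∉ U, Q)`.

In the language of the revealed cluster `R = C₁` this is `E[F(R) · 1[a₃ ∈ R] · (π′_R(o) − γ)] ≤ 0`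
for every nonnegative increasing `F` (layer cake over `𝓤`), the boundary of what the avoidance
inequality gives for the cross term (J1): the CENTRED statement `Cov(F, 1[a₃ ∈ R](π′_R(o) − γ)) ≤ 0`
((PSI₁) of proofs/MINE1-J1.md §10) is the open content.

Proof: as for `jOneB` with `𝓥 = {S | a₃ ∈ S} ∩ 𝓤` in place of `{S | a₃ ∈ S}`.
-/

namespace Summit.Ventures.PercRepro2

section JOneBUpset

variable {V : Type*} {E : Type*} [Fintype E] [DecidableEq E] [Fintype V] [DecidableEq V]
  {R : Type*} [CommRing R] [LinearOrder R] [IsStrictOrderedRing R]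

omit [Fintype E] [DecidableEq E] [Fintype V] [DecidableEq V] in
/-- `{C(x) ∈ {S | v ∈ S} ∩ 𝓤} = {x ↔ v} ∩ {C(x) ∈ 𝓤}`. -/
lemma jOneB_clusterInEvent_mem_inter (ends : E → Sym2 V) (x v : V) (𝓤 : Set (Set V)) :
    clusterInEvent ends x ({S : Set V | v ∈ S} ∩ 𝓤) = connEvent ends x v ∩ clusterInEvent ends x 𝓤 := by
  ext ω
  simp [clusterInEvent, connEvent]

/-- **The avoidance odds `q2 = P(o ∈ C₂ | a₂ ↮ a₁, a₂ ↮ a₃)` are at most `γ`**, multiplied out: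
`P(o ∈ C₂, a₂ ↮ {a₁, a₃}) · P(a₃ ∉ U, Q) ≤ P(a₂ ↮ {a₁, a₃}) · P(o ∈ U, a₃ ∉ U, Q)`. -/
theorem jOneB_avoid_le (p : E → R) (hp : IsProbVec p) (ends : E → Sym2 V) (o a₁ a₂ a₃ : V) :
    prob p (connEvent ends a₂ o ∩ ((connEvent ends a₁ a₂)ᶜ ∩ (connEvent ends a₂ a₃)ᶜ)) *
        prob p ((connEvent ends a₁ a₃)ᶜ ∩ (connEvent ends a₂ a₃)ᶜ ∩ (connEvent ends a₁ a₂)ᶜ) ≤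
      prob p ((connEvent ends a₁ a₂)ᶜ ∩ (connEvent ends a₂ a₃)ᶜ) *
        prob p ((connEvent ends a₁ o ∪ connEvent ends a₂ o) ∩ (connEvent ends a₁ a₃)ᶜ ∩
          (connEvent ends a₂ a₃)ᶜ ∩ (connEvent ends a₁ a₂)ᶜ) := by
  classical
  have key := bhk_cross_cluster_avoid p hp ends a₂ a₁ (X := {a₁, a₃}) (by simp)
    (jOneB_isUpperSet_mem (V := V) o) (jOneB_isUpperSet_mem (V := V) a₃)
  rw [jOneB_clusterInEvent_mem, jOneB_clusterInEvent_mem, jOneB_avoidAll_pair,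
    connEvent_comm ends a₂ a₁] at key
  set Q := (connEvent ends a₁ a₂)ᶜ with hQ
  set Ax := Q ∩ (connEvent ends a₂ a₃)ᶜ with hAx
  -- `Dx = C₀ + D`
  have hDx := prob_inter_add_prob_inter_compl p Ax (connEvent ends a₁ a₃)
  have e4 : Ax ∩ (connEvent ends a₁ a₃)ᶜ =
      (connEvent ends a₁ a₃)ᶜ ∩ (connEvent ends a₂ a₃)ᶜ ∩ Q := by
    ext ω
    simp only [hAx, Set.mem_inter_iff, Set.mem_compl_iff, mem_connEvent]
    tauto
  rw [e4] at hDx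
  -- `B = A₀ + A₀'`, `A₀' ≤ P(o ∈ U, a₃ ∉ U, Q)`
  have hB := prob_inter_add_prob_inter_compl p (connEvent ends a₂ o ∩ Ax) (connEvent ends a₁ a₃)
  have e5 : connEvent ends a₂ o ∩ Ax ∩ connEvent ends a₁ a₃ =
      connEvent ends a₂ o ∩ connEvent ends a₁ a₃ ∩ Ax := by
    ext ω
    simp only [Set.mem_inter_iff]
    tauto
  rw [e5] at hB
  have hA' : prob p (connEvent ends a₂ o ∩ Ax ∩ (connEvent ends a₁ a₃)ᶜ) ≤
      prob p ((connEvent ends a₁ o ∪ connEvent ends a₂ o) ∩ (connEvent ends a₁ a₃)ᶜ ∩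
        (connEvent ends a₂ a₃)ᶜ ∩ Q) := by
    refine prob_mono hp ?_
    intro ω hω
    simp only [hAx, Set.mem_inter_iff, Set.mem_compl_iff, mem_connEvent, Set.mem_union] at hω ⊢
    tauto
  have hDx0 : 0 ≤ prob p Ax := prob_nonneg hp _
  have hB0 : 0 ≤ prob p (connEvent ends a₂ o ∩ Ax) := prob_nonneg hp _
  have hC0 : 0 ≤ prob p (Ax ∩ connEvent ends a₁ a₃) := prob_nonneg hp _
  -- `B · D = B · Dx − B · C₀ ≤ B · Dx − A₀ · Dx = Dx · A₀' ≤ Dx · Do`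
  have hAC : Ax ∩ connEvent ends a₁ a₃ = connEvent ends a₁ a₃ ∩ Ax := Set.inter_comm _ _
  rw [hAC] at hDx hC0
  nlinarith [key, hDx, hB, mul_le_mul_of_nonneg_left hA' hDx0, hB0, hC0]

/-- **(b) with an up-set, multiplied out**: for an up-set `𝓤` of vertex sets,
`P(o ∈ C₂, a₃ ∈ C₁, C₁ ∈ 𝓤, Q) · P(a₃ ∉ U, Q) ≤ P(a₃ ∈ C₁, C₁ ∈ 𝓤, Q) · P(o ∈ U, a₃ ∉ U, Q)`,
i.e. `P(o ∈ C₂ | a₃ ∈ C₁, C₁ ∈ 𝓤, Q) ≤ γ`.  Proof: `q1_𝓤 ≤ q2` (the avoidance inequality with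
`𝓥 = {S ∋ a₃} ∩ 𝓤`) and `q2 ≤ γ` (`jOneB_avoid_le`). -/
theorem jOneB_upset (p : E → R) (hp : IsProbVec p) (ends : E → Sym2 V) (o a₁ a₂ a₃ : V)
    {𝓤 : Set (Set V)} (h𝓤 : IsUpperSet 𝓤) :
    prob p (connEvent ends a₂ o ∩ (connEvent ends a₁ a₃ ∩ clusterInEvent ends a₁ 𝓤) ∩
        (connEvent ends a₁ a₂)ᶜ) *
        prob p ((connEvent ends a₁ a₃)ᶜ ∩ (connEvent ends a₂ a₃)ᶜ ∩ (connEvent ends a₁ a₂)ᶜ) ≤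
      prob p ((connEvent ends a₁ a₃ ∩ clusterInEvent ends a₁ 𝓤) ∩ (connEvent ends a₁ a₂)ᶜ) *
        prob p ((connEvent ends a₁ o ∪ connEvent ends a₂ o) ∩ (connEvent ends a₁ a₃)ᶜ ∩
          (connEvent ends a₂ a₃)ᶜ ∩ (connEvent ends a₁ a₂)ᶜ) := by
  classical
  have h𝓥 : IsUpperSet ({S : Set V | a₃ ∈ S} ∩ 𝓤) :=
    (jOneB_isUpperSet_mem (V := V) a₃).inter h𝓤
  have key := bhk_cross_cluster_avoid p hp ends a₂ a₁ (X := {a₁, a₃}) (by simp)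
    (jOneB_isUpperSet_mem (V := V) o) h𝓥
  rw [jOneB_clusterInEvent_mem, jOneB_clusterInEvent_mem_inter, jOneB_avoidAll_pair,
    connEvent_comm ends a₂ a₁] at key
  have key2 := jOneB_avoid_le p hp ends o a₁ a₂ a₃
  set Q := (connEvent ends a₁ a₂)ᶜ with hQ
  set Ax := Q ∩ (connEvent ends a₂ a₃)ᶜ with hAx
  set A₃ := connEvent ends a₁ a₃ ∩ clusterInEvent ends a₁ 𝓤 with hA₃
  set D := prob p ((connEvent ends a₁ a₃)ᶜ ∩ (connEvent ends a₂ a₃)ᶜ ∩ Q) with hD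
  set Do := prob p ((connEvent ends a₁ o ∪ connEvent ends a₂ o) ∩ (connEvent ends a₁ a₃)ᶜ ∩
    (connEvent ends a₂ a₃)ᶜ ∩ Q) with hDo
  -- on `{a₁ ↔ a₃} ∩ Q` the avoidance of `a₃` by `a₂` is automatic
  have e1 : connEvent ends a₂ o ∩ A₃ ∩ Ax = connEvent ends a₂ o ∩ A₃ ∩ Q := by
    ext ω
    simp only [hAx, hQ, hA₃, Set.mem_inter_iff, Set.mem_compl_iff, mem_connEvent]
    constructor
    · rintro ⟨⟨ho, h13, hU⟩, h12, _⟩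
      exact ⟨⟨ho, h13, hU⟩, h12⟩
    · rintro ⟨⟨ho, h13, hU⟩, h12⟩
      exact ⟨⟨ho, h13, hU⟩, h12, jOneB_not_conn_of_conn h13 h12⟩
  have e2 : A₃ ∩ Ax = A₃ ∩ Q := by
    ext ω
    simp only [hAx, hQ, hA₃, Set.mem_inter_iff, Set.mem_compl_iff, mem_connEvent]
    constructor
    · rintro ⟨⟨h13, hU⟩, h12, _⟩
      exact ⟨⟨h13, hU⟩, h12⟩
    · rintro ⟨⟨h13, hU⟩, h12⟩
      exact ⟨⟨h13, hU⟩, h12, jOneB_not_conn_of_conn h13 h12⟩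
  have hAsub : prob p (connEvent ends a₂ o ∩ A₃ ∩ Q) ≤ prob p Ax := by
    rw [← e1]
    exact prob_mono hp (Set.inter_subset_right)
  rw [e1, e2] at key
  have hA0 : 0 ≤ prob p (connEvent ends a₂ o ∩ A₃ ∩ Q) := prob_nonneg hp _
  have hC0 : 0 ≤ prob p (A₃ ∩ Q) := prob_nonneg hp _
  have hD0 : 0 ≤ D := prob_nonneg hp _
  have hDo0 : 0 ≤ Do := prob_nonneg hp _
  have hDx0 : 0 ≤ prob p Ax := prob_nonneg hp _
  -- `A · D · Dx ≤ B · C · D ≤ C · Dx · Do`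
  have h1 : prob p (connEvent ends a₂ o ∩ A₃ ∩ Q) * D * prob p Ax ≤
      prob p (A₃ ∩ Q) * (prob p Ax * Do) := by
    nlinarith [mul_le_mul_of_nonneg_right key hD0, mul_le_mul_of_nonneg_left key2 hC0]
  rcases eq_or_lt_of_le hDx0 with hzero | hpos
  · -- `Dx = 0` forces `A = 0`
    have : prob p (connEvent ends a₂ o ∩ A₃ ∩ Q) = 0 := le_antisymm (hzero ▸ hAsub) hA0
    rw [this, zero_mul]
    exact mul_nonneg hC0 hDo0
  · have h2 : (prob p (connEvent ends a₂ o ∩ A₃ ∩ Q) * D) * prob p Ax ≤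
        (prob p (A₃ ∩ Q) * Do) * prob p Ax := by
      calc (prob p (connEvent ends a₂ o ∩ A₃ ∩ Q) * D) * prob p Ax
          ≤ prob p (A₃ ∩ Q) * (prob p Ax * Do) := h1
        _ = (prob p (A₃ ∩ Q) * Do) * prob p Ax := by ring
    exact le_of_mul_le_mul_right h2 hpos

end JOneBUpset

end Summit.Ventures.PercRepro2
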